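import Summits.Ventures.CertifiedManyBodySolver.Rows.AndersonHalfFilledBlock

/-!
# Half-filled block lemma — rectangle-cluster forms (sr-mbsolver cal-3, gen 9)

HONEST FRAMING: first certified bounds; not a superconductivity verdict; every number certified
or labelled float. This file only re-packages
`posSemidef_andersonCluster_sub_smul_of_halfFilled_block` / `_of_sector_block` (file
`AndersonHalfFilledBlock.lean`, Lieb 1989 spin-reflection positivity + the `SU(2)` ladder) for the
2-D lane-A rows `anderson_psd_rect*` of
`Summits/HubbardSuperconductivity/ManyBodyBootstrap/Bounds/AndersonRowsSquare.lean`, whose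
operator is `andersonCluster (rectWindow Lx Ly) t U (rectBondWeights w) (rectSiteWeights v)`:

* `card_rectWindow : (rectWindow a b).card = a * b` (the tree had only the private membership
  lemma);
* `posSemidef_andersonRect_sub_smul_of_halfFilled_block`: the `N = Lx·Ly` block of `h - q·1` PSD
  ⇒ `h - q·1` PSD (`U ≥ 0`, `v c r ≥ 0`);
* `posSemidef_andersonRect_sub_smul_of_sector_block`: one `(a, b)` block, `a + b = Lx·Ly`,
  `|a - b| ≤ 1`, PSD ⇒ `h - q·1` PSD. On a `4 × 4` cluster the `(8, 8)` block has
  `C(16,8)² = 165 636 900` rows against `4¹⁶ = 4 294 967 296` (÷ 26).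

References: E. H. Lieb, Phys. Rev. Lett. 62 (1989) 1201, Theorem 2 [LiebPRL1989].
-/

namespace Summit.Ventures.CertifiedManyBodySolver.Rows

open Matrix Finset Literature.MathematicalPhysics.QuantumLattice
  Literature.MathematicalPhysics.QuantumLattice.AndersonCluster Literature.Probability.LatticeModels
open scoped ComplexOrder

/-- `|[0,a) × [0,b)| = a·b`. [folklore] -/
theorem card_rectWindow (a b : ℕ) : (rectWindow a b).card = a * b := by
  classical
  have hmem : ∀ x : Site 2, x ∈ rectWindow a b ↔ (0 ≤ x 0 ∧ x 0 < a) ∧ (0 ≤ x 1 ∧ x 1 < b) := by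
    intro x
    rw [rectWindow, Finset.mem_filter, mem_halfOpenBox, Fin.forall_fin_two]
    push_cast
    constructor
    · rintro ⟨⟨h0, h1⟩, ha, hb⟩
      exact ⟨⟨h0.1, ha⟩, ⟨h1.1, hb⟩⟩
    · rintro ⟨⟨h0, ha⟩, ⟨h1, hb⟩⟩
      exact ⟨⟨⟨h0, by omega⟩, ⟨h1, by omega⟩⟩, ha, hb⟩
  let f : Fin a × Fin b → Site 2 := fun p => ![((p.1 : ℕ) : ℤ), ((p.2 : ℕ) : ℤ)]
  have hf0 : ∀ p, f p 0 = ((p.1 : ℕ) : ℤ) := fun p => rfl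
  have hf1 : ∀ p, f p 1 = ((p.2 : ℕ) : ℤ) := fun p => rfl
  have hf : Function.Injective f := by
    rintro ⟨c, r⟩ ⟨c', r'⟩ h
    have h0 := congr_fun h 0
    have h1 := congr_fun h 1
    rw [hf0, hf0, Nat.cast_inj] at h0
    rw [hf1, hf1, Nat.cast_inj] at h1
    exact Prod.ext (Fin.ext h0) (Fin.ext h1)
  have himg : rectWindow a b = Finset.univ.image f := by
    ext x
    rw [hmem, Finset.mem_image]
    constructor
    · rintro ⟨⟨h0, ha⟩, ⟨h1, hb⟩⟩
      refine ⟨(⟨(x 0).toNat, by omega⟩, ⟨(x 1).toNat, by omega⟩), Finset.mem_univ _, ?_⟩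
      ext i
      fin_cases i
      · show (((x 0).toNat : ℕ) : ℤ) = x 0
        exact Int.toNat_of_nonneg h0
      · show (((x 1).toNat : ℕ) : ℤ) = x 1
        exact Int.toNat_of_nonneg h1
    · rintro ⟨⟨c, r⟩, -, rfl⟩
      rw [hf0, hf1]
      exact ⟨⟨by positivity, by exact_mod_cast c.isLt⟩, ⟨by positivity, by exact_mod_cast r.isLt⟩⟩
  rw [himg, Finset.card_image_of_injective _ hf, Finset.card_univ, Fintype.card_prod,
    Fintype.card_fin, Fintype.card_fin]

/-- `|PolySite ([0,a) × [0,b))| = a·b` for the rectangle cluster. [folklore] -/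
theorem card_polySite_rectWindow (a b : ℕ) : Fintype.card (PolySite (rectWindow a b)) = a * b := by
  rw [ThermodynamicLimit.card_polySite, card_rectWindow]

/-- Entrywise nonnegative rectangle site weights are nonnegative. [folklore] -/
theorem rectSiteWeights_nonneg {v : ℕ → ℕ → ℝ} (hv : ∀ c r, 0 ≤ v c r) (x : Site 2) :
    0 ≤ rectSiteWeights v x :=
  hv _ _

/-- **Rectangle rows, half-filled block**: for the weighted Anderson operator of the open rectangle
cluster `[0,Lx) × [0,Ly) ⊆ ℤ²` (`U ≥ 0`, site weights `v c r ≥ 0`), `PosSemidef` of the `N = Lx·Ly`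
block of `h - q·1` gives `h - q·1 ⪰ 0` on the whole Fock space — the hypothesis shape of the
`anderson_psd_rect*` claim nodes. [cite: LiebPRL1989, Theorem 2 and its proof] -/
theorem posSemidef_andersonRect_sub_smul_of_halfFilled_block (Lx Ly : ℕ) (t : ℝ) {U : ℝ}
    (hU : 0 ≤ U) (w : ℕ → ℕ → Fin 2 → ℝ) {v : ℕ → ℕ → ℝ} (hv : ∀ c r, 0 ≤ v c r) {q : ℝ}
    (hblk : ((andersonCluster (rectWindow Lx Ly) t U (rectBondWeights w)
        (rectSiteWeights v)).toBlock (fun s => s.card = Lx * Ly) (fun s => s.card = Lx * Ly) -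
        (q : ℂ) • 1).PosSemidef) :
    (andersonCluster (rectWindow Lx Ly) t U (rectBondWeights w) (rectSiteWeights v) -
      (q : ℂ) • (1 : FermionOp (rectWindow Lx Ly))).PosSemidef := by
  refine posSemidef_andersonCluster_sub_smul_of_halfFilled_block _ t hU _
    (rectSiteWeights_nonneg hv) ?_
  rw [card_polySite_rectWindow]
  exact hblk

/-- **Rectangle rows, one `(N↑, N↓)` block**: for the open rectangle cluster `[0,Lx) × [0,Ly)`
(`U ≥ 0`, `v c r ≥ 0`), `PosSemidef` of the `(a, b)` block of `h - q·1` with `a + b = Lx·Ly`,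
`|a - b| ≤ 1` (e.g. `(8, 8)` on `4 × 4`: `C(16,8)² = 165 636 900` rows instead of `4¹⁶`) gives
`h - q·1 ⪰ 0` on the whole Fock space. [cite: LiebPRL1989, proof of Theorems 1 and 2] -/
theorem posSemidef_andersonRect_sub_smul_of_sector_block (Lx Ly : ℕ) (t : ℝ) {U : ℝ} (hU : 0 ≤ U)
    (w : ℕ → ℕ → Fin 2 → ℝ) {v : ℕ → ℕ → ℝ} (hv : ∀ c r, 0 ≤ v c r) {a b : ℕ}
    (hab : a + b = Lx * Ly) (ha : a ≤ b + 1) (hb : b ≤ a + 1) {q : ℝ}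
    (hblk : ((andersonCluster (rectWindow Lx Ly) t U (rectBondWeights w)
        (rectSiteWeights v)).toBlock (fun s => (upPart s).card = a ∧ (downPart s).card = b)
        (fun s => (upPart s).card = a ∧ (downPart s).card = b) - (q : ℂ) • 1).PosSemidef) :
    (andersonCluster (rectWindow Lx Ly) t U (rectBondWeights w) (rectSiteWeights v) -
      (q : ℂ) • (1 : FermionOp (rectWindow Lx Ly))).PosSemidef :=
  posSemidef_andersonCluster_sub_smul_of_sector_block _ t hU _ (rectSiteWeights_nonneg hv)
    (hab.trans (card_polySite_rectWindow Lx Ly).symm) ha hb hblk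

end Summit.Ventures.CertifiedManyBodySolver.Rows
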